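import Mathlib
import Summits.ValiantsHypothesis.ValiantsHypothesis.Theses.BarrierLever
import Summits.ValiantsHypothesis.ValiantsHypothesis.Theorems.BarrierLeverLevelCollapse
import Summits.ValiantsHypothesis.ValiantsHypothesis.Theorems.BarrierLeverDefinableEquationsStatus

/-!
# Crux `BarrierLever.DefinableEquations` (stmt-ValiantsHypothesis-8745) — the assembly needs the
# crux only INFINITELY OFTEN; the route's open load is the implication `SHS → DefEq_io` (lead c5)

The route's deciding theorem `closes : SuccinctHittingSetsForVP → DefinableEquations →
ValiantsHypothesis` consumes the crux `DefinableEquations` (∃ a ∀ b, FOR ALL LARGE n, a nonzero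
level-`a` boolean-sum equation against `SmallCircuits ℂ n b`) at ONE `n` per `(a', b)`, and the
other crux `SuccinctHittingSetsForVP` supplies hitting for ALL large `n`; so the weaker statement

  `DefEq_io` : ∃ a ∀ b ∀ n₀ ∃ n ≥ n₀ ∃ q ≤ N^a ∃ H, L(H), deg H ≤ N^a ∧ boolSum H ≠ 0 ∧
               boolSum H vanishes on coeff(SmallCircuits ℂ n b)            (`N = C(2n,n)`)

(the crux with "eventually in `n`" replaced by "infinitely often in `n`") already gives
`SuccinctHittingSetsForVP → ValiantsHypothesis` (`valiantsHypothesis_of_succinct_of_io`, the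
assembly re-run through `levelCollapse_proof`).  On the other hand `DefEq_io` HOLDS OUTRIGHT if
`SuccinctHittingSetsForVP` fails (lead c4's `Status.definableEquations_io_of_not_succinctHittingSetsForVP`:
a failure of FSV Question 6 at level `a` is, for every `b`, a level-`a` distinguisher equation
infinitely often, and distinguishers are boolean sums with `q = 0`).  Hence, unconditionally,
`SuccinctHittingSetsForVP ∨ DefEq_io` (`succinct_or_io`), `(SuccinctHittingSetsForVP → DefEq_io) ↔ DefEq_io`
(`imp_iff_io`), and the whole open content of route BarrierLever is the pair
{`SuccinctHittingSetsForVP`, `SuccinctHittingSetsForVP → DefEq_io`} (`valiantsHypothesis_of_imp`):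
the crux as filed (a.e. in `n`) is stronger than what the lever uses, and its i.o. weakening is
decided — positively — in the world where the route's other crux fails.  `not_io_iff` spells out
what refuting even the weak form means: for every level `a` some size exponent `b` makes the
coefficient vectors of `SmallCircuits ℂ n b` hit every nonzero level-`a` boolean sum FOR ALL LARGE
`n` ("VNP(N)-succinct hitting sets from VP", Chatterjee–Tengse arXiv:2309.07612 Def. 21–23 with
𝒟 = VNP, almost-everywhere form).  Pure logic over the tree's definitions; no definitions, no facts.
The i.o. statement is a local notation `(∃ a : ℕ, ∀ b n₀ : ℕ, ∃ n : ℕ, n₀ ≤ n ∧ ∃ q : ℕ, q ≤ (Nat.choose (2 * n) n) ^ a ∧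
      ∃ H : MvPolynomial (↥(degLEMonomials n) ⊕ Fin q) ℂ,
        complexity H ≤ (Nat.choose (2 * n) n) ^ a ∧ H.totalDegree ≤ (Nat.choose (2 * n) n) ^ a ∧
        boolSum H ≠ 0 ∧
        ∀ f ∈ SmallCircuits ℂ n b, eval (coeffVector (degLEMonomials n) f) (boolSum H) = 0)` (written out in full in each docstring's prose; no definition is introduced).
-/

set_option linter.dupNamespace false

noncomputable section

namespace Summit.ValiantsHypothesis.ValiantsHypothesis.Theorems.BarrierLeverDefinableEquations

open MvPolynomial
open Literature.Computability.AlgebraicComplexity Literature.Barriers.ValiantsHypothesis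
open Summit.ValiantsHypothesis.ValiantsHypothesis.Theses.BarrierLever
open scoped BigOperators

namespace InfinitelyOften

/- `DefEq_io` (written out in every statement below; no definition is introduced): the crux
`DefinableEquations` with "for all large `n`" weakened to "for infinitely many `n`" —
  `∃ a, ∀ b n₀, ∃ n ≥ n₀, ∃ q ≤ N^a, ∃ H, L(H) ≤ N^a ∧ deg H ≤ N^a ∧ boolSum H ≠ 0 ∧`
  `∀ f ∈ SmallCircuits ℂ n b, eval (coeffVector (degLEMonomials n) f) (boolSum H) = 0`. -/

/-- **The lever runs on `DefEq_io`.**  `SuccinctHittingSetsForVP` and the infinitely-often form of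
the crux give `VP_ℂ ≠ VNP_ℂ`: under `VP = VNP`, `levelCollapse_proof` turns level-`a` boolean sums
into level-`a'` distinguishers for all `n ≥ n₁`; FSV Question 6 at `a'` gives `b, n₀` with hitting
for all `n ≥ n₀`; `DefEq_io` at `(b, n₀ + n₁)` gives ONE `n ≥ n₀ + n₁` with a nonzero boolean-sum
equation against `SmallCircuits ℂ n b` — a distinguisher that is hit, contradiction.  (The assembly
`closes` verbatim, with the crux's `∀ n ≥ n₀'` used at a single `n`.) [folklore] -/
theorem valiantsHypothesis_of_succinct_of_io
    (hSHS : Summit.ValiantsHypothesis.ValiantsHypothesis.Theses.BarrierLever.SuccinctHittingSetsForVP)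
    (hio : (∃ a : ℕ, ∀ b n₀ : ℕ, ∃ n : ℕ, n₀ ≤ n ∧ ∃ q : ℕ, q ≤ (Nat.choose (2 * n) n) ^ a ∧
      ∃ H : MvPolynomial (↥(degLEMonomials n) ⊕ Fin q) ℂ,
        complexity H ≤ (Nat.choose (2 * n) n) ^ a ∧ H.totalDegree ≤ (Nat.choose (2 * n) n) ^ a ∧
        boolSum H ≠ 0 ∧
        ∀ f ∈ SmallCircuits ℂ n b, eval (coeffVector (degLEMonomials n) f) (boolSum H) = 0)) : _root_.ValiantsHypothesis := by
  classical
  refine Classical.byContradiction fun hV => ?_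
  obtain ⟨a, ha⟩ := hio
  obtain ⟨a', n₁, hcol⟩ := Summit.ValiantsHypothesis.Theorems.levelCollapse_proof hV a
  obtain ⟨b, n₀, hhit⟩ := hSHS a'
  obtain ⟨n, hn, q, hq, H, hHc, hHd, hne, hvan⟩ := ha b (n₀ + n₁)
  obtain ⟨f, hf, hfne⟩ := hhit n (by omega) _ (hcol n (by omega) q hq H hHc hHd) hne
  exact hfne (hvan f hf)

/-- The crux as filed (for all large `n`) implies its infinitely-often form. [folklore] -/
theorem io_of_definableEquations (h : DefinableEquations) : (∃ a : ℕ, ∀ b n₀ : ℕ, ∃ n : ℕ, n₀ ≤ n ∧ ∃ q : ℕ, q ≤ (Nat.choose (2 * n) n) ^ a ∧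
      ∃ H : MvPolynomial (↥(degLEMonomials n) ⊕ Fin q) ℂ,
        complexity H ≤ (Nat.choose (2 * n) n) ^ a ∧ H.totalDegree ≤ (Nat.choose (2 * n) n) ^ a ∧
        boolSum H ≠ 0 ∧
        ∀ f ∈ SmallCircuits ℂ n b, eval (coeffVector (degLEMonomials n) f) (boolSum H) = 0) := by
  obtain ⟨a, ha⟩ := h
  refine ⟨a, fun b n₀ => ?_⟩
  obtain ⟨n₀', h'⟩ := ha b
  obtain ⟨q, hq, H, hHc, hHd, hne, hvan⟩ := h' (max n₀ n₀') (le_max_right _ _)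
  exact ⟨max n₀ n₀', le_max_left _ _, q, hq, H, hHc, hHd, hne, hvan⟩

/-- **`DefEq_io` holds outright if FSV Question 6 fails** (lead c4's
`Status.definableEquations_io_of_not_succinctHittingSetsForVP`, restated: a failure of
`SuccinctHittingSetsForVP` at level `a` is, for every `b`, infinitely often a nonzero level-`a`
distinguisher vanishing on coeff(`SmallCircuits ℂ n b`), i.e. a boolean sum with `q = 0`). [folklore] -/
theorem io_of_not_succinct
    (h : ¬ Summit.ValiantsHypothesis.ValiantsHypothesis.Theses.BarrierLever.SuccinctHittingSetsForVP) :
    (∃ a : ℕ, ∀ b n₀ : ℕ, ∃ n : ℕ, n₀ ≤ n ∧ ∃ q : ℕ, q ≤ (Nat.choose (2 * n) n) ^ a ∧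
      ∃ H : MvPolynomial (↥(degLEMonomials n) ⊕ Fin q) ℂ,
        complexity H ≤ (Nat.choose (2 * n) n) ^ a ∧ H.totalDegree ≤ (Nat.choose (2 * n) n) ^ a ∧
        boolSum H ≠ 0 ∧
        ∀ f ∈ SmallCircuits ℂ n b, eval (coeffVector (degLEMonomials n) f) (boolSum H) = 0) :=
  Status.definableEquations_io_of_not_succinctHittingSetsForVP h

/-- **Unconditional dichotomy**: either succinct hitting sets for VP exist (FSV Question 6 "yes",
the route's rank-2 crux) or the infinitely-often form of `DefinableEquations` holds. [folklore] -/
theorem succinct_or_io :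
    Summit.ValiantsHypothesis.ValiantsHypothesis.Theses.BarrierLever.SuccinctHittingSetsForVP ∨ (∃ a : ℕ, ∀ b n₀ : ℕ, ∃ n : ℕ, n₀ ≤ n ∧ ∃ q : ℕ, q ≤ (Nat.choose (2 * n) n) ^ a ∧
      ∃ H : MvPolynomial (↥(degLEMonomials n) ⊕ Fin q) ℂ,
        complexity H ≤ (Nat.choose (2 * n) n) ^ a ∧ H.totalDegree ≤ (Nat.choose (2 * n) n) ^ a ∧
        boolSum H ≠ 0 ∧
        ∀ f ∈ SmallCircuits ℂ n b, eval (coeffVector (degLEMonomials n) f) (boolSum H) = 0) := by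
  by_cases h : Summit.ValiantsHypothesis.ValiantsHypothesis.Theses.BarrierLever.SuccinctHittingSetsForVP
  · exact Or.inl h
  · exact Or.inr (io_of_not_succinct h)

/-- **The open load of the route is one implication.**  `DefEq_io` is equivalent to
`SuccinctHittingSetsForVP → DefEq_io` (the `¬SHS` world is settled by `io_of_not_succinct`). [folklore] -/
theorem imp_iff_io :
    (Summit.ValiantsHypothesis.ValiantsHypothesis.Theses.BarrierLever.SuccinctHittingSetsForVP → (∃ a : ℕ, ∀ b n₀ : ℕ, ∃ n : ℕ, n₀ ≤ n ∧ ∃ q : ℕ, q ≤ (Nat.choose (2 * n) n) ^ a ∧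
      ∃ H : MvPolynomial (↥(degLEMonomials n) ⊕ Fin q) ℂ,
        complexity H ≤ (Nat.choose (2 * n) n) ^ a ∧ H.totalDegree ≤ (Nat.choose (2 * n) n) ^ a ∧
        boolSum H ≠ 0 ∧
        ∀ f ∈ SmallCircuits ℂ n b, eval (coeffVector (degLEMonomials n) f) (boolSum H) = 0)) ↔
      (∃ a : ℕ, ∀ b n₀ : ℕ, ∃ n : ℕ, n₀ ≤ n ∧ ∃ q : ℕ, q ≤ (Nat.choose (2 * n) n) ^ a ∧
      ∃ H : MvPolynomial (↥(degLEMonomials n) ⊕ Fin q) ℂ,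
        complexity H ≤ (Nat.choose (2 * n) n) ^ a ∧ H.totalDegree ≤ (Nat.choose (2 * n) n) ^ a ∧
        boolSum H ≠ 0 ∧
        ∀ f ∈ SmallCircuits ℂ n b, eval (coeffVector (degLEMonomials n) f) (boolSum H) = 0) := by
  constructor
  · intro h
    by_cases hS : Summit.ValiantsHypothesis.ValiantsHypothesis.Theses.BarrierLever.SuccinctHittingSetsForVP
    · exact h hS
    · exact io_of_not_succinct hS
  · exact fun h _ => h

/-- **Route BarrierLever re-assembled on the weak crux**: FSV Question 6 "yes" together with the
single implication "if FSV Question 6 holds then VP has VNP(N)-natural proofs infinitely often at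
one uniform level" gives `VP_ℂ ≠ VNP_ℂ`. [folklore] -/
theorem valiantsHypothesis_of_imp
    (himp : Summit.ValiantsHypothesis.ValiantsHypothesis.Theses.BarrierLever.SuccinctHittingSetsForVP → (∃ a : ℕ, ∀ b n₀ : ℕ, ∃ n : ℕ, n₀ ≤ n ∧ ∃ q : ℕ, q ≤ (Nat.choose (2 * n) n) ^ a ∧
      ∃ H : MvPolynomial (↥(degLEMonomials n) ⊕ Fin q) ℂ,
        complexity H ≤ (Nat.choose (2 * n) n) ^ a ∧ H.totalDegree ≤ (Nat.choose (2 * n) n) ^ a ∧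
        boolSum H ≠ 0 ∧
        ∀ f ∈ SmallCircuits ℂ n b, eval (coeffVector (degLEMonomials n) f) (boolSum H) = 0))
    (hSHS : Summit.ValiantsHypothesis.ValiantsHypothesis.Theses.BarrierLever.SuccinctHittingSetsForVP) :
    _root_.ValiantsHypothesis :=
  valiantsHypothesis_of_succinct_of_io hSHS (himp hSHS)

/-- The route's target `LeverThesis = SHS ∧ DefinableEquations` implies the weakened pair
`SHS ∧ DefEq_io`, which already closes the summit (`valiantsHypothesis_of_succinct_of_io`). [folklore] -/
theorem succinct_and_io_of_leverThesis (h : LeverThesis) :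
    Summit.ValiantsHypothesis.ValiantsHypothesis.Theses.BarrierLever.SuccinctHittingSetsForVP ∧ (∃ a : ℕ, ∀ b n₀ : ℕ, ∃ n : ℕ, n₀ ≤ n ∧ ∃ q : ℕ, q ≤ (Nat.choose (2 * n) n) ^ a ∧
      ∃ H : MvPolynomial (↥(degLEMonomials n) ⊕ Fin q) ℂ,
        complexity H ≤ (Nat.choose (2 * n) n) ^ a ∧ H.totalDegree ≤ (Nat.choose (2 * n) n) ^ a ∧
        boolSum H ≠ 0 ∧
        ∀ f ∈ SmallCircuits ℂ n b, eval (coeffVector (degLEMonomials n) f) (boolSum H) = 0) :=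
  ⟨h.1, io_of_definableEquations h.2⟩

/-- **Refuting even the weak crux.**  `¬ DefEq_io` unfolded: for every level `a` there are a size
exponent `b` and a threshold `n₀` such that for ALL `n ≥ n₀` every nonzero level-`a` boolean sum
(`q ≤ N^a`, `L(H), deg H ≤ N^a`) is nonzero at the coefficient vector of some
`f ∈ SmallCircuits ℂ n b` — VNP(N)-succinct hitting sets from VP, almost everywhere in `n`
(Chatterjee–Tengse arXiv:2309.07612, Def. 21–23 with 𝒟 = VNP).  With `succinct_or_io` this world
also satisfies FSV Question 6. [folklore] -/
theorem not_io_iff :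
    ¬ (∃ a : ℕ, ∀ b n₀ : ℕ, ∃ n : ℕ, n₀ ≤ n ∧ ∃ q : ℕ, q ≤ (Nat.choose (2 * n) n) ^ a ∧
      ∃ H : MvPolynomial (↥(degLEMonomials n) ⊕ Fin q) ℂ,
        complexity H ≤ (Nat.choose (2 * n) n) ^ a ∧ H.totalDegree ≤ (Nat.choose (2 * n) n) ^ a ∧
        boolSum H ≠ 0 ∧
        ∀ f ∈ SmallCircuits ℂ n b, eval (coeffVector (degLEMonomials n) f) (boolSum H) = 0) ↔
      ∀ a : ℕ, ∃ b n₀ : ℕ, ∀ n : ℕ, n₀ ≤ n → ∀ q : ℕ, q ≤ (Nat.choose (2 * n) n) ^ a →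
        ∀ H : MvPolynomial (↥(degLEMonomials n) ⊕ Fin q) ℂ,
          complexity H ≤ (Nat.choose (2 * n) n) ^ a → H.totalDegree ≤ (Nat.choose (2 * n) n) ^ a →
          boolSum H ≠ 0 →
          ∃ f ∈ SmallCircuits ℂ n b, eval (coeffVector (degLEMonomials n) f) (boolSum H) ≠ 0 := by
  constructor
  · intro h a
    by_contra hcon
    push Not at hcon
    apply h
    refine ⟨a, fun b n₀ => ?_⟩
    obtain ⟨n, hn, q, hq, H, hHc, hHd, hne, hvan⟩ := hcon b n₀
    exact ⟨n, hn, q, hq, H, hHc, hHd, hne, hvan⟩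
  · rintro h ⟨a, ha⟩
    obtain ⟨b, n₀, hb⟩ := h a
    obtain ⟨n, hn, q, hq, H, hHc, hHd, hne, hvan⟩ := ha b n₀
    obtain ⟨f, hf, hfne⟩ := hb n hn q hq H hHc hHd hne
    exact hfne (hvan f hf)

/-- Refuting the weak crux refutes the crux as filed and leaves FSV Question 6 true: the world
`¬ DefEq_io` is the world "VP-succinct generators hit VNP(N) almost everywhere", in which route
BarrierLever is dead with BOTH constructive statements false and its hypothesis crux true. [folklore] -/
theorem succinct_and_not_definableEquations_of_not_io (h : ¬ (∃ a : ℕ, ∀ b n₀ : ℕ, ∃ n : ℕ, n₀ ≤ n ∧ ∃ q : ℕ, q ≤ (Nat.choose (2 * n) n) ^ a ∧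
      ∃ H : MvPolynomial (↥(degLEMonomials n) ⊕ Fin q) ℂ,
        complexity H ≤ (Nat.choose (2 * n) n) ^ a ∧ H.totalDegree ≤ (Nat.choose (2 * n) n) ^ a ∧
        boolSum H ≠ 0 ∧
        ∀ f ∈ SmallCircuits ℂ n b, eval (coeffVector (degLEMonomials n) f) (boolSum H) = 0)) :
    Summit.ValiantsHypothesis.ValiantsHypothesis.Theses.BarrierLever.SuccinctHittingSetsForVP ∧
      ¬ DefinableEquations :=
  ⟨(succinct_or_io.resolve_right h), fun hD => h (io_of_definableEquations hD)⟩

end InfinitelyOften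

/-- **Registered sub-goal `valiantsHypothesis_of_succinct_of_io` (verbatim signature).**  The lever
runs on the infinitely-often form of the crux: `SuccinctHittingSetsForVP → DefEq_io → VP_ℂ ≠ VNP_ℂ`
(`InfinitelyOften.valiantsHypothesis_of_succinct_of_io`). [folklore] -/
theorem valiantsHypothesis_of_succinct_of_io :
    Summit.ValiantsHypothesis.ValiantsHypothesis.Theses.BarrierLever.SuccinctHittingSetsForVP → (∃ a : ℕ, ∀ b n₀ : ℕ, ∃ n : ℕ, n₀ ≤ n ∧ ∃ q : ℕ, q ≤ (Nat.choose (2 * n) n) ^ a ∧ ∃ H : MvPolynomial (↥(Literature.Barriers.ValiantsHypothesis.degLEMonomials n) ⊕ Fin q) ℂ, Literature.Computability.AlgebraicComplexity.complexity H ≤ (Nat.choose (2 * n) n) ^ a ∧ H.totalDegree ≤ (Nat.choose (2 * n) n) ^ a ∧ Literature.Computability.AlgebraicComplexity.boolSum H ≠ 0 ∧ ∀ f ∈ Literature.Barriers.ValiantsHypothesis.SmallCircuits ℂ n b, MvPolynomial.eval (Literature.Barriers.ValiantsHypothesis.coeffVector (Literature.Barriers.ValiantsHypothesis.degLEMonomials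 n) f) (Literature.Computability.AlgebraicComplexity.boolSum H) = 0) → ValiantsHypothesis :=
  fun hS hio => InfinitelyOften.valiantsHypothesis_of_succinct_of_io hS hio

end Summit.ValiantsHypothesis.ValiantsHypothesis.Theorems.BarrierLeverDefinableEquations

end
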